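import Summits.Ventures.LatticeQCDFlow.Scaling.GraphGroundState

/-!
HONEST FRAMING: exact (Metropolis-corrected) sampling algorithms for lattice gauge theory; figures
of merit are autocorrelation/cost numbers at stated couplings and volumes; no continuum-physics
claim.

# GroundStateIdentities — THE VERTEX EQUATIONS OF A SWAP LIST, PAIRED WITH A WEIGHT: THE TRACE IDENTITY `ρ·Σ_kc_k = h·c_0`, THE FLUX IDENTITY ON A SET OF LEVELS,
# THE ENERGY IDENTITY `ρ·Σ_kc_k² = (t/m)Σ_r(c_{i_r} − c_{l_r})² + h·c_0²`, THE GROUND-STATE REPRESENTATION `E(v) − ρ·Σ_kv_k² = (t/m)Σ_r c_{i_r}c_{l_r}(v_{i_r}/c_{i_r} − v_{l_r}/c_{l_r})²`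
# AND ITS CONSEQUENCES: RAYLEIGH CEILINGS ON `ρ` BY TEST VECTORS, UNIQUENESS OF `ρ`, PROPORTIONALITY OF POSITIVE SOLUTIONS, COMPARISON OF LISTS (lean-2 GEN-48, ours)

Venture-side (OURS).  Cell `lqcd-flow` (pub-lqcd), unit `pub-lqcd-lean-2-g48`, 2026-08-31.  Chapter AI (the sizes of the Robin ground state), file 1 — Mathlib only (through chapter AH
file 8's edge form `gs_form_pairing`).  Chapter AH reduced the two-sided mixing law of the homogeneous exchange scheme on a swap list `e : Fin m → levels²` (swap rate `t/m` per entry, hot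
rate `h` at level `0`) to a positive solution `(c, ρ)` of the VERTEX EQUATIONS `(t/m)Σ_r[1{k=i_r}(c_{l_r}−c_{i_r}) + 1{k=l_r}(c_{i_r}−c_{l_r})] − 1{k=0}h·c_k = −ρ·c_k` (file 8: it exists on
every connected list).  This file pairs the equations with an arbitrary weight vector `w` — `(t/m)Σ_r(c_{i_r} − c_{l_r})(w_{i_r} − w_{l_r}) + h·c_0w_0 = ρ·Σ_kw_kc_k` — and reads off, for ANY
solution: `w = 𝟙` the TRACE identity (the Laplacian is traceless against constants: `ρΣc = hc_0`, the product form of chapter AG's Robin equation on any topology); `w = 𝟙_A` the FLUX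
identity; `w = c` the ENERGY identity; `w = v²/c` (for `c ≠ 0`) the GROUND-STATE REPRESENTATION with its non-negative right side for `c > 0` — so `ρ` is the bottom of the Rayleigh
quotient of `E(v) = (t/m)Σ_r(v_{i_r} − v_{l_r})² + h·v_0²`: every test vector is a ceiling (`𝟙`: `ρ(K+1) ≤ h`; `𝟙_A`: `ρ·#A ≤ (t/m)·Σ_r(1_A(i_r) − 1_A(l_r))² + h·1{0∈A}`; `e_k`: the degree
bound), two positive solutions have the same `ρ` and — on a connected list — proportional vectors, and domination of energies compares the rates of two lists on the same levels
(monotone in `t` and `h`; a super-list with `m' ≥ m` entries has `ρ' ≥ (m/m')ρ`).  No definitions; no chain in this file.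

* §1 `vertexEq_pairing`, `groundState_trace`, `groundState_flux`, `groundState_energy`; §2 `groundState_representation`, `groundState_rayleigh`, `groundState_rho_le_hot`,
  `indicator_sub_sq`, `groundState_rho_le_cut`, `groundState_rho_le_degree`; §3 `groundState_rho_unique`, `groundState_proportional`, `groundState_rho_mono_of_dominates`,
  `groundState_rho_mono_rates`, `groundState_rho_superlist_ge`.

Reading (no numerics implied): with chapter AH file 7 the ceiling `⌈(1/ρ)·log(4Σc/c_min)⌉` and the floor's unit `(1−ρ)/ρ` are now controlled by test vectors and energy comparisons
alone; file 3 of this chapter turns the trace identity into `Σc/c_min = h/ρ`.  Literature grade (cell rule): ELEMENTARY (Dirichlet principle ∕ ground-state transform for a symmetric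
matrix with non-negative off-diagonal entries), NEW TYPING; nothing cited; no new bib keys.
-/

noncomputable section

open Finset

namespace Summit.Ventures.LatticeQCDFlow.Scaling

section Identities
variable {K m : ℕ} (e : Fin m → Fin (K + 1) × Fin (K + 1)) {t h ρ : ℝ} {c : Fin (K + 1) → ℝ}

/-! ## §1 The pairing and three identities -/

/-- **THE VERTEX EQUATIONS PAIRED WITH A WEIGHT VECTOR:** `(t/m)Σ_r(c_{i_r} − c_{l_r})(w_{i_r} − w_{l_r}) + h·c_0·w_0 = ρ·Σ_kw_kc_k`. [ours] -/
theorem vertexEq_pairing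
    (hvertex : ∀ k : Fin (K + 1), t / m * ∑ r : Fin m, ((if k = (e r).1 then c (e r).2 - c (e r).1 else 0) + (if k = (e r).2 then c (e r).1 - c (e r).2 else 0))
      - (if k = 0 then h * c k else 0) = -ρ * c k) (w : Fin (K + 1) → ℝ) :
    t / m * ∑ r : Fin m, (c (e r).1 - c (e r).2) * (w (e r).1 - w (e r).2) + h * c 0 * w 0 = ρ * ∑ k : Fin (K + 1), w k * c k := by
  have hsum : ∑ k : Fin (K + 1), w k * (t / m * ∑ r : Fin m, ((if k = (e r).1 then c (e r).2 - c (e r).1 else 0) + (if k = (e r).2 then c (e r).1 - c (e r).2 else 0))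
      - (if k = 0 then h * c k else 0)) = ∑ k : Fin (K + 1), w k * (-ρ * c k) := sum_congr rfl fun k _ => by rw [hvertex k]
  have hpair := gs_form_pairing e c w
  have hL : ∑ k : Fin (K + 1), w k * (t / m * ∑ r : Fin m, ((if k = (e r).1 then c (e r).2 - c (e r).1 else 0) + (if k = (e r).2 then c (e r).1 - c (e r).2 else 0))
      - (if k = 0 then h * c k else 0))
      = t / m * ∑ k : Fin (K + 1), w k * ∑ r : Fin m, ((if k = (e r).1 then c (e r).2 - c (e r).1 else 0) + (if k = (e r).2 then c (e r).1 - c (e r).2 else 0))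
        - h * c 0 * w 0 := by
    simp_rw [mul_sub, sum_sub_distrib]
    congr 1
    · rw [mul_sum]; exact sum_congr rfl fun k _ => by ring
    · simp_rw [mul_ite, mul_zero]
      rw [sum_ite_eq' univ (0 : Fin (K + 1)), if_pos (mem_univ _)]; ring
  have hR : ∑ k : Fin (K + 1), w k * (-ρ * c k) = -ρ * ∑ k : Fin (K + 1), w k * c k := by
    rw [mul_sum]; exact sum_congr rfl fun k _ => by ring
  rw [hL, hR, hpair] at hsum
  linear_combination (-1 : ℝ) * hsum

/-- **THE TRACE IDENTITY: `ρ·Σ_kc_k = h·c_0`** (the Laplacian terms cancel against the constant weight). [ours] -/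
theorem groundState_trace
    (hvertex : ∀ k : Fin (K + 1), t / m * ∑ r : Fin m, ((if k = (e r).1 then c (e r).2 - c (e r).1 else 0) + (if k = (e r).2 then c (e r).1 - c (e r).2 else 0))
      - (if k = 0 then h * c k else 0) = -ρ * c k) :
    ρ * ∑ k : Fin (K + 1), c k = h * c 0 := by
  have hp := vertexEq_pairing e hvertex (fun _ => 1)
  simp only [sub_self, mul_zero, sum_const_zero, zero_add, mul_one, one_mul] at hp
  linarith

/-- **THE FLUX IDENTITY on a set of levels `A`:** `(t/m)Σ_r(c_{i_r} − c_{l_r})(1_A(i_r) − 1_A(l_r)) + 1{0∈A}·h·c_0 = ρ·Σ_{k∈A}c_k` — only the listed pairs crossing `A` contribute,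
each by `c_in − c_out`. [ours] -/
theorem groundState_flux
    (hvertex : ∀ k : Fin (K + 1), t / m * ∑ r : Fin m, ((if k = (e r).1 then c (e r).2 - c (e r).1 else 0) + (if k = (e r).2 then c (e r).1 - c (e r).2 else 0))
      - (if k = 0 then h * c k else 0) = -ρ * c k) (A : Finset (Fin (K + 1))) :
    t / m * ∑ r : Fin m, (c (e r).1 - c (e r).2) * ((if (e r).1 ∈ A then (1 : ℝ) else 0) - (if (e r).2 ∈ A then (1 : ℝ) else 0))
      + (if (0 : Fin (K + 1)) ∈ A then h * c 0 else 0) = ρ * ∑ k ∈ A, c k := by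
  have hp := vertexEq_pairing e hvertex (fun k => if k ∈ A then (1 : ℝ) else 0)
  have h0 : h * c 0 * (if (0 : Fin (K + 1)) ∈ A then (1 : ℝ) else 0) = (if (0 : Fin (K + 1)) ∈ A then h * c 0 else 0) := by
    split_ifs <;> ring
  have hA : ∑ k : Fin (K + 1), (if k ∈ A then (1 : ℝ) else 0) * c k = ∑ k ∈ A, c k := by
    simp_rw [boole_mul]
    rw [sum_ite_mem, univ_inter]
  rw [h0, hA] at hp
  exact hp

/-- **THE ENERGY IDENTITY: `ρ·Σ_kc_k² = (t/m)Σ_r(c_{i_r} − c_{l_r})² + h·c_0²`.** [ours] -/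
theorem groundState_energy
    (hvertex : ∀ k : Fin (K + 1), t / m * ∑ r : Fin m, ((if k = (e r).1 then c (e r).2 - c (e r).1 else 0) + (if k = (e r).2 then c (e r).1 - c (e r).2 else 0))
      - (if k = 0 then h * c k else 0) = -ρ * c k) :
    ρ * ∑ k : Fin (K + 1), c k ^ 2 = t / m * ∑ r : Fin m, (c (e r).1 - c (e r).2) ^ 2 + h * c 0 ^ 2 := by
  have hp := vertexEq_pairing e hvertex c
  have e1 : ∑ k : Fin (K + 1), c k * c k = ∑ k : Fin (K + 1), c k ^ 2 := sum_congr rfl fun k _ => by ring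
  have e2 : ∑ r : Fin m, (c (e r).1 - c (e r).2) * (c (e r).1 - c (e r).2) = ∑ r : Fin m, (c (e r).1 - c (e r).2) ^ 2 := sum_congr rfl fun r _ => by ring
  rw [e1, e2] at hp
  linear_combination (-1 : ℝ) * hp

/-! ## §2 The ground-state representation and Rayleigh ceilings -/

/-- **THE GROUND-STATE REPRESENTATION** (`c_k ≠ 0` for all `k`): for every vector `v`,
`(t/m)Σ_r(v_{i_r} − v_{l_r})² + h·v_0² − ρ·Σ_kv_k² = (t/m)Σ_r c_{i_r}c_{l_r}(v_{i_r}/c_{i_r} − v_{l_r}/c_{l_r})²`. [ours] -/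
theorem groundState_representation (hc : ∀ k, c k ≠ 0)
    (hvertex : ∀ k : Fin (K + 1), t / m * ∑ r : Fin m, ((if k = (e r).1 then c (e r).2 - c (e r).1 else 0) + (if k = (e r).2 then c (e r).1 - c (e r).2 else 0))
      - (if k = 0 then h * c k else 0) = -ρ * c k) (v : Fin (K + 1) → ℝ) :
    t / m * ∑ r : Fin m, (v (e r).1 - v (e r).2) ^ 2 + h * v 0 ^ 2 - ρ * ∑ k : Fin (K + 1), v k ^ 2
      = t / m * ∑ r : Fin m, c (e r).1 * c (e r).2 * (v (e r).1 / c (e r).1 - v (e r).2 / c (e r).2) ^ 2 := by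
  have hp := vertexEq_pairing e hvertex (fun k => v k ^ 2 / c k)
  have h0 : h * c 0 * (v 0 ^ 2 / c 0) = h * v 0 ^ 2 := by field_simp [hc 0]
  have hZ : ∑ k : Fin (K + 1), v k ^ 2 / c k * c k = ∑ k : Fin (K + 1), v k ^ 2 := sum_congr rfl fun k _ => div_mul_cancel₀ _ (hc k)
  rw [h0, hZ] at hp
  have hedge : ∀ r : Fin m, (v (e r).1 - v (e r).2) ^ 2 - (c (e r).1 - c (e r).2) * (v (e r).1 ^ 2 / c (e r).1 - v (e r).2 ^ 2 / c (e r).2)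
      = c (e r).1 * c (e r).2 * (v (e r).1 / c (e r).1 - v (e r).2 / c (e r).2) ^ 2 := by
    intro r
    have h1 := hc (e r).1
    have h2 := hc (e r).2
    field_simp
    ring
  have hsum : ∑ r : Fin m, (v (e r).1 - v (e r).2) ^ 2 - ∑ r : Fin m, (c (e r).1 - c (e r).2) * (v (e r).1 ^ 2 / c (e r).1 - v (e r).2 ^ 2 / c (e r).2)
      = ∑ r : Fin m, c (e r).1 * c (e r).2 * (v (e r).1 / c (e r).1 - v (e r).2 / c (e r).2) ^ 2 := by
    rw [← sum_sub_distrib]; exact sum_congr rfl fun r _ => hedge r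
  rw [← hsum, mul_sub]
  linarith

/-- **THE RAYLEIGH CEILING: for a positive solution and `t ≥ 0`, every vector `v` has `ρ·Σ_kv_k² ≤ (t/m)Σ_r(v_{i_r} − v_{l_r})² + h·v_0²`.** [ours] -/
theorem groundState_rayleigh (hc : ∀ k, 0 < c k) (ht : 0 ≤ t)
    (hvertex : ∀ k : Fin (K + 1), t / m * ∑ r : Fin m, ((if k = (e r).1 then c (e r).2 - c (e r).1 else 0) + (if k = (e r).2 then c (e r).1 - c (e r).2 else 0))
      - (if k = 0 then h * c k else 0) = -ρ * c k) (v : Fin (K + 1) → ℝ) :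
    ρ * ∑ k : Fin (K + 1), v k ^ 2 ≤ t / m * ∑ r : Fin m, (v (e r).1 - v (e r).2) ^ 2 + h * v 0 ^ 2 := by
  have hrep := groundState_representation e (fun k => (hc k).ne') hvertex v
  have hnn : 0 ≤ t / m * ∑ r : Fin m, c (e r).1 * c (e r).2 * (v (e r).1 / c (e r).1 - v (e r).2 / c (e r).2) ^ 2 :=
    mul_nonneg (div_nonneg ht (Nat.cast_nonneg m)) (sum_nonneg fun r _ => mul_nonneg (mul_nonneg (hc _).le (hc _).le) (sq_nonneg _))
  linarith

/-- **The constant test vector: `ρ·(K+1) ≤ h`.** [ours] -/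
theorem groundState_rho_le_hot (hc : ∀ k, 0 < c k) (ht : 0 ≤ t)
    (hvertex : ∀ k : Fin (K + 1), t / m * ∑ r : Fin m, ((if k = (e r).1 then c (e r).2 - c (e r).1 else 0) + (if k = (e r).2 then c (e r).1 - c (e r).2 else 0))
      - (if k = 0 then h * c k else 0) = -ρ * c k) :
    ρ * ((K : ℝ) + 1) ≤ h := by
  have hr := groundState_rayleigh e hc ht hvertex (fun _ => 1)
  have h1 : ∑ _k : Fin (K + 1), (1 : ℝ) = (K : ℝ) + 1 := by simp
  have h2 : ∑ _r : Fin m, ((1 : ℝ) - 1) ^ 2 = 0 := by simp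
  simp only [one_pow, h1, h2, mul_zero, zero_add, mul_one] at hr
  exact hr

/-- The squared difference of two indicators is the indicator of "exactly one": in `{0, 1}`, and `≤ 1`. [ours] -/
theorem indicator_sub_sq (P Q : Prop) [Decidable P] [Decidable Q] :
    ((if P then (1 : ℝ) else 0) - (if Q then (1 : ℝ) else 0)) ^ 2 = (if (P ∧ ¬Q) ∨ (Q ∧ ¬P) then (1 : ℝ) else 0) := by
  by_cases hP : P <;> by_cases hQ : Q <;> simp [hP, hQ]

/-- **The indicator test vector (Cheeger-type ceiling): `ρ·#A ≤ (t/m)·#{r : exactly one endpoint in A} + 1{0∈A}·h`** — a set of levels far from the hot seat with few crossing pairs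
keeps `ρ` small. [ours] -/
theorem groundState_rho_le_cut (hc : ∀ k, 0 < c k) (ht : 0 ≤ t)
    (hvertex : ∀ k : Fin (K + 1), t / m * ∑ r : Fin m, ((if k = (e r).1 then c (e r).2 - c (e r).1 else 0) + (if k = (e r).2 then c (e r).1 - c (e r).2 else 0))
      - (if k = 0 then h * c k else 0) = -ρ * c k) (A : Finset (Fin (K + 1))) :
    ρ * (A.card : ℝ) ≤ t / m * ((univ.filter fun r : Fin m => ((e r).1 ∈ A ∧ (e r).2 ∉ A) ∨ ((e r).2 ∈ A ∧ (e r).1 ∉ A)).card : ℝ) + (if (0 : Fin (K + 1)) ∈ A then h else 0) := by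
  have hr := groundState_rayleigh e hc ht hvertex (fun k => if k ∈ A then (1 : ℝ) else 0)
  have hA : ∑ k : Fin (K + 1), (if k ∈ A then (1 : ℝ) else 0) ^ 2 = A.card := by
    simp_rw [ite_pow, one_pow, zero_pow two_ne_zero]
    rw [sum_ite_mem, univ_inter, sum_const, nsmul_eq_mul, mul_one]
  have hE : ∑ r : Fin m, ((if (e r).1 ∈ A then (1 : ℝ) else 0) - (if (e r).2 ∈ A then (1 : ℝ) else 0)) ^ 2
      = ((univ.filter fun r : Fin m => ((e r).1 ∈ A ∧ (e r).2 ∉ A) ∨ ((e r).2 ∈ A ∧ (e r).1 ∉ A)).card : ℝ) := by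
    simp_rw [indicator_sub_sq]
    rw [sum_boole]
  have h0 : h * (if (0 : Fin (K + 1)) ∈ A then (1 : ℝ) else 0) ^ 2 = (if (0 : Fin (K + 1)) ∈ A then h else 0) := by
    split_ifs <;> ring
  rw [hA, hE, h0] at hr
  exact hr

/-- **The one-level test vector (degree ceiling):** with distinct endpoints, `ρ ≤ (t/m)·deg(k) + 1{k=0}·h`, `deg(k) = #{r : k ∈ {i_r, l_r}}`. [ours] -/
theorem groundState_rho_le_degree (he : ∀ r, (e r).1 ≠ (e r).2) (hc : ∀ k, 0 < c k) (ht : 0 ≤ t)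
    (hvertex : ∀ k : Fin (K + 1), t / m * ∑ r : Fin m, ((if k = (e r).1 then c (e r).2 - c (e r).1 else 0) + (if k = (e r).2 then c (e r).1 - c (e r).2 else 0))
      - (if k = 0 then h * c k else 0) = -ρ * c k) (k : Fin (K + 1)) :
    ρ ≤ t / m * ((univ.filter fun r : Fin m => (e r).1 = k ∨ (e r).2 = k).card : ℝ) + (if k = 0 then h else 0) := by
  have hcut := groundState_rho_le_cut e hc ht hvertex {k}
  have hcard : (univ.filter fun r : Fin m =>
        ((e r).1 ∈ ({k} : Finset (Fin (K + 1))) ∧ (e r).2 ∉ ({k} : Finset (Fin (K + 1)))) ∨ ((e r).2 ∈ ({k} : Finset (Fin (K + 1))) ∧ (e r).1 ∉ ({k} : Finset (Fin (K + 1))))).card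
      = (univ.filter fun r : Fin m => (e r).1 = k ∨ (e r).2 = k).card := by
    congr 1
    refine filter_congr fun r _ => ?_
    simp only [mem_singleton]
    constructor
    · intro hx
      rcases hx with ⟨h1, _⟩ | ⟨h2, _⟩
      · exact Or.inl h1
      · exact Or.inr h2
    · intro hx
      rcases hx with h1 | h2
      · exact Or.inl ⟨h1, fun h2 => he r (h1.trans h2.symm)⟩
      · exact Or.inr ⟨h2, fun h1 => he r (h1.trans h2.symm)⟩
  have hif : (if (0 : Fin (K + 1)) ∈ ({k} : Finset (Fin (K + 1))) then h else 0) = (if k = 0 then h else 0) := by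
    by_cases hk : k = 0
    · rw [if_pos hk, if_pos (mem_singleton.mpr hk.symm)]
    · rw [if_neg hk, if_neg (fun h0 => hk (mem_singleton.mp h0).symm)]
  rw [card_singleton, Nat.cast_one, mul_one, hcard, hif] at hcut
  exact hcut

/-! ## §3 Uniqueness, proportionality, comparison -/

variable {m' : ℕ} {t' h' ρ' : ℝ} {c' : Fin (K + 1) → ℝ}

/-- **COMPARISON BY DOMINATION OF ENERGIES:** two lists on the same levels with positive solutions `(c, ρ)` (rates `t ≥ 0`, `h`) and `(c', ρ')` (rates `t'`, `h'`); if
`κ·E(v) ≤ E'(v)` for every `v` (`κ ≥ 0`), then **`κ·ρ ≤ ρ'`** (`κρΣc'² ≤ κE(c') ≤ E'(c') = ρ'Σc'²`). [ours] -/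
theorem groundState_rho_mono_of_dominates (hc : ∀ k, 0 < c k) (ht : 0 ≤ t)
    (hvertex : ∀ k : Fin (K + 1), t / m * ∑ r : Fin m, ((if k = (e r).1 then c (e r).2 - c (e r).1 else 0) + (if k = (e r).2 then c (e r).1 - c (e r).2 else 0))
      - (if k = 0 then h * c k else 0) = -ρ * c k)
    (e' : Fin m' → Fin (K + 1) × Fin (K + 1)) (hc' : ∀ k, 0 < c' k)
    (hvertex' : ∀ k : Fin (K + 1), t' / m' * ∑ r : Fin m', ((if k = (e' r).1 then c' (e' r).2 - c' (e' r).1 else 0) + (if k = (e' r).2 then c' (e' r).1 - c' (e' r).2 else 0))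
      - (if k = 0 then h' * c' k else 0) = -ρ' * c' k)
    {κ : ℝ} (hκ : 0 ≤ κ) (hdom : ∀ v : Fin (K + 1) → ℝ, κ * (t / m * ∑ r : Fin m, (v (e r).1 - v (e r).2) ^ 2 + h * v 0 ^ 2)
      ≤ t' / m' * ∑ r : Fin m', (v (e' r).1 - v (e' r).2) ^ 2 + h' * v 0 ^ 2) :
    κ * ρ ≤ ρ' := by
  have hS : 0 < ∑ k : Fin (K + 1), c' k ^ 2 := by
    have : c' 0 ^ 2 ≤ ∑ k : Fin (K + 1), c' k ^ 2 := Finset.single_le_sum (fun k _ => sq_nonneg (c' k)) (mem_univ 0)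
    nlinarith [hc' 0]
  have hray := groundState_rayleigh e hc ht hvertex c'
  have hen := groundState_energy e' hvertex'
  have hd := hdom c'
  have h1 : κ * (ρ * ∑ k : Fin (K + 1), c' k ^ 2) ≤ ρ' * ∑ k : Fin (K + 1), c' k ^ 2 := by
    rw [hen]; exact le_trans (mul_le_mul_of_nonneg_left hray hκ) hd
  have h2 : (κ * ρ) * ∑ k : Fin (K + 1), c' k ^ 2 ≤ ρ' * ∑ k : Fin (K + 1), c' k ^ 2 := by rw [mul_assoc]; exact h1
  exact le_of_mul_le_mul_right h2 hS

/-- **MONOTONICITY IN THE RATES on one list:** positive solutions for `(t, h)` and `(t', h')` with `0 ≤ t ≤ t'`, `h ≤ h'` have `ρ ≤ ρ'`. [ours] -/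
theorem groundState_rho_mono_rates (hc : ∀ k, 0 < c k) (ht : 0 ≤ t) (htt : t ≤ t') (hhh : h ≤ h')
    (hvertex : ∀ k : Fin (K + 1), t / m * ∑ r : Fin m, ((if k = (e r).1 then c (e r).2 - c (e r).1 else 0) + (if k = (e r).2 then c (e r).1 - c (e r).2 else 0))
      - (if k = 0 then h * c k else 0) = -ρ * c k)
    (hc' : ∀ k, 0 < c' k)
    (hvertex' : ∀ k : Fin (K + 1), t' / m * ∑ r : Fin m, ((if k = (e r).1 then c' (e r).2 - c' (e r).1 else 0) + (if k = (e r).2 then c' (e r).1 - c' (e r).2 else 0))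
      - (if k = 0 then h' * c' k else 0) = -ρ' * c' k) :
    ρ ≤ ρ' := by
  have h := groundState_rho_mono_of_dominates e hc ht hvertex e hc' hvertex' zero_le_one (fun v => by
    have hX : 0 ≤ ∑ r : Fin m, (v (e r).1 - v (e r).2) ^ 2 := sum_nonneg fun r _ => sq_nonneg _
    have h1 : t / m * ∑ r : Fin m, (v (e r).1 - v (e r).2) ^ 2 ≤ t' / m * ∑ r : Fin m, (v (e r).1 - v (e r).2) ^ 2 :=
      mul_le_mul_of_nonneg_right (div_le_div_of_nonneg_right htt (Nat.cast_nonneg m)) hX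
    have h2 : h * v 0 ^ 2 ≤ h' * v 0 ^ 2 := mul_le_mul_of_nonneg_right hhh (sq_nonneg _)
    linarith)
  linarith

/-- **UNIQUENESS OF THE RATE:** two positive solutions of the same vertex equations (`t ≥ 0`) have the same `ρ`. [ours] -/
theorem groundState_rho_unique (hc : ∀ k, 0 < c k) (ht : 0 ≤ t)
    (hvertex : ∀ k : Fin (K + 1), t / m * ∑ r : Fin m, ((if k = (e r).1 then c (e r).2 - c (e r).1 else 0) + (if k = (e r).2 then c (e r).1 - c (e r).2 else 0))
      - (if k = 0 then h * c k else 0) = -ρ * c k)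
    (hc' : ∀ k, 0 < c' k)
    (hvertex' : ∀ k : Fin (K + 1), t / m * ∑ r : Fin m, ((if k = (e r).1 then c' (e r).2 - c' (e r).1 else 0) + (if k = (e r).2 then c' (e r).1 - c' (e r).2 else 0))
      - (if k = 0 then h * c' k else 0) = -ρ' * c' k) :
    ρ = ρ' :=
  le_antisymm (groundState_rho_mono_rates e hc ht le_rfl le_rfl hvertex hc' hvertex') (groundState_rho_mono_rates e hc' ht le_rfl le_rfl hvertex' hc hvertex)

/-- **PROPORTIONALITY OF POSITIVE SOLUTIONS on a connected list** (`m ≥ 1`, `t > 0`, every non-empty proper set of levels crossed by a listed pair): two positive solutions are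
proportional, `c'_k = (c'_0/c_0)·c_k`. [ours] -/
theorem groundState_proportional (hm : 1 ≤ m) (ht : 0 < t)
    (hconn : ∀ A : Finset (Fin (K + 1)), A.Nonempty → A ≠ univ → ∃ r : Fin m, ((e r).1 ∈ A ∧ (e r).2 ∉ A) ∨ ((e r).2 ∈ A ∧ (e r).1 ∉ A))
    (hc : ∀ k, 0 < c k)
    (hvertex : ∀ k : Fin (K + 1), t / m * ∑ r : Fin m, ((if k = (e r).1 then c (e r).2 - c (e r).1 else 0) + (if k = (e r).2 then c (e r).1 - c (e r).2 else 0))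
      - (if k = 0 then h * c k else 0) = -ρ * c k)
    (hc' : ∀ k, 0 < c' k)
    (hvertex' : ∀ k : Fin (K + 1), t / m * ∑ r : Fin m, ((if k = (e r).1 then c' (e r).2 - c' (e r).1 else 0) + (if k = (e r).2 then c' (e r).1 - c' (e r).2 else 0))
      - (if k = 0 then h * c' k else 0) = -ρ' * c' k) :
    ∀ k, c' k = c' 0 / c 0 * c k := by
  have hmpos : (0 : ℝ) < m := Nat.cast_pos.mpr (by omega)
  have hρ : ρ = ρ' := groundState_rho_unique e hc ht.le hvertex hc' hvertex'
  have hrep := groundState_representation e (fun k => (hc k).ne') hvertex c'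
  have hen := groundState_energy e hvertex'
  rw [← hρ] at hen
  have hzero : t / m * ∑ r : Fin m, c (e r).1 * c (e r).2 * (c' (e r).1 / c (e r).1 - c' (e r).2 / c (e r).2) ^ 2 = 0 := by rw [← hrep, hen]; ring
  have hterms : ∀ r : Fin m, 0 ≤ c (e r).1 * c (e r).2 * (c' (e r).1 / c (e r).1 - c' (e r).2 / c (e r).2) ^ 2 :=
    fun r => mul_nonneg (mul_nonneg (hc _).le (hc _).le) (sq_nonneg _)
  have hsum0 : ∑ r : Fin m, c (e r).1 * c (e r).2 * (c' (e r).1 / c (e r).1 - c' (e r).2 / c (e r).2) ^ 2 = 0 := by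
    rcases mul_eq_zero.mp hzero with h0 | h0
    · exfalso; exact (div_pos ht hmpos).ne' h0
    · exact h0
  have hedge : ∀ r : Fin m, c' (e r).1 / c (e r).1 = c' (e r).2 / c (e r).2 := by
    intro r
    have h0 := (sum_eq_zero_iff_of_nonneg fun r _ => hterms r).mp hsum0 r (mem_univ r)
    rcases mul_eq_zero.mp h0 with h1 | h1
    · exfalso; exact (mul_pos (hc _) (hc _)).ne' h1
    · exact sub_eq_zero.mp (pow_eq_zero_iff two_ne_zero |>.mp h1)
  set A : Finset (Fin (K + 1)) := univ.filter fun k => c' k / c k = c' 0 / c 0 with hA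
  have hAuniv : A = univ := by
    by_contra hne
    have hne0 : A.Nonempty := ⟨0, by rw [hA, mem_filter]; exact ⟨mem_univ _, rfl⟩⟩
    obtain ⟨r, hr⟩ := hconn A hne0 hne
    rcases hr with ⟨h1, h2⟩ | ⟨h2, h1⟩
    · apply h2; rw [hA, mem_filter] at h1 ⊢; exact ⟨mem_univ _, (hedge r).symm.trans h1.2⟩
    · apply h1; rw [hA, mem_filter] at h2 ⊢; exact ⟨mem_univ _, (hedge r).trans h2.2⟩
  intro k
  have hk : k ∈ A := by rw [hAuniv]; exact mem_univ k
  rw [hA, mem_filter] at hk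
  rw [← hk.2, div_mul_cancel₀ _ (hc k).ne']

/-- **A SUPER-LIST DILUTES THE RATE BY AT MOST `m/m'`:** if `e = e' ∘ ι` for an injection `ι : Fin m → Fin m'` (every entry of `e` is an entry of `e'`), same `t ≥ 0` and `h ≥ 0`, positive
solutions: **`(m/m')·ρ ≤ ρ'`**. [ours] -/
theorem groundState_rho_superlist_ge (hm : 1 ≤ m) (ht : 0 ≤ t) (hh : 0 ≤ h) (e' : Fin m' → Fin (K + 1) × Fin (K + 1)) {ι : Fin m → Fin m'} (hι : Function.Injective ι)
    (heι : ∀ r, e r = e' (ι r)) (hc : ∀ k, 0 < c k)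
    (hvertex : ∀ k : Fin (K + 1), t / m * ∑ r : Fin m, ((if k = (e r).1 then c (e r).2 - c (e r).1 else 0) + (if k = (e r).2 then c (e r).1 - c (e r).2 else 0))
      - (if k = 0 then h * c k else 0) = -ρ * c k)
    (hc' : ∀ k, 0 < c' k)
    (hvertex' : ∀ k : Fin (K + 1), t / m' * ∑ r : Fin m', ((if k = (e' r).1 then c' (e' r).2 - c' (e' r).1 else 0) + (if k = (e' r).2 then c' (e' r).1 - c' (e' r).2 else 0))
      - (if k = 0 then h * c' k else 0) = -ρ' * c' k) :
    (m : ℝ) / m' * ρ ≤ ρ' := by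
  have hmpos : (0 : ℝ) < m := Nat.cast_pos.mpr (by omega)
  have hmm : m ≤ m' := by simpa using Fintype.card_le_of_injective ι hι
  have hm'pos : (0 : ℝ) < m' := Nat.cast_pos.mpr (by omega)
  refine groundState_rho_mono_of_dominates e hc ht hvertex e' hc' hvertex' (κ := (m : ℝ) / m') (by positivity) fun v => ?_
  have hsub : ∑ r : Fin m, (v (e r).1 - v (e r).2) ^ 2 ≤ ∑ r : Fin m', (v (e' r).1 - v (e' r).2) ^ 2 := by
    have : ∑ r : Fin m, (v (e r).1 - v (e r).2) ^ 2 = ∑ r ∈ univ.map ⟨ι, hι⟩, (v (e' r).1 - v (e' r).2) ^ 2 := by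
      rw [sum_map]; exact sum_congr rfl fun r _ => by rw [heι r]; rfl
    rw [this]
    exact sum_le_univ_sum_of_nonneg fun r => sq_nonneg _
  have h1 : (m : ℝ) / m' * (t / m * ∑ r : Fin m, (v (e r).1 - v (e r).2) ^ 2) = t / m' * ∑ r : Fin m, (v (e r).1 - v (e r).2) ^ 2 := by
    field_simp
  have h2 : t / m' * ∑ r : Fin m, (v (e r).1 - v (e r).2) ^ 2 ≤ t / m' * ∑ r : Fin m', (v (e' r).1 - v (e' r).2) ^ 2 :=
    mul_le_mul_of_nonneg_left hsub (div_nonneg ht hm'pos.le)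
  have hmm' : (m : ℝ) / m' ≤ 1 := (div_le_one hm'pos).mpr (Nat.cast_le.mpr hmm)
  have h3 : (m : ℝ) / m' * (h * v 0 ^ 2) ≤ h * v 0 ^ 2 := by
    have : 0 ≤ h * v 0 ^ 2 := mul_nonneg hh (sq_nonneg _)
    nlinarith
  rw [mul_add, h1]
  linarith

end Identities

end Summit.Ventures.LatticeQCDFlow.Scaling

end
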